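import Summits.Ventures.PercRepro.ProfileThreeNoSplit
import Summits.Ventures.PercRepro.C025ProfileSimpleReduction
import Summits.Ventures.PercRepro.ProfileTopLevel

/-!
# PercRepro — THE ROW `q = 3` OF (Π) LIFTS OVER A POINT OF A LINE WITH AT LEAST FOUR POINTS, AND THE REDUCTION OF
THE ROW TO THE SIMPLE MATROIDS WITH SHORT LINES (p10, gen 6; `proofs/P10-Q3-NOSPLIT.md` §3)

A point `z` of a rank-2 set `L` with `≥ 4` points, any two of which span a rank-2 set (a line of a simple
matroid), has no `z`-split set (`ProfileThreeNoSplit`): a rank-3 set `B ∌ z` either contains two points of `L`,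
which span `z` (`mem_clF_pair_of_line`), or leaves two points of `L ∖ z` in `E ∖ B ∖ z`, which then spans `z`,
so `z` is not a coloop of `E ∖ B`.  Hence, by Theorem A, `(Π_{3,u})(M ∖ z) ⟹ (Π_{3,u})(M)` for every `u ≥ 4`
(`profileIneq_three_of_four_point_line`, and `profileIneq_three_of_four_point_line_simple` for a simple `M`).

THE REDUCTION (`profileIneq_three_of_simple_short_lines`): strong induction on `|E|` for a fixed level `u ≥ 4` —
a loop is deleted (night-3's `profileIneq_of_delete_isLoop`); a parallel pair `e ∥ f` is handled by night-3 g7's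
parallel step `profileIneq_of_delete_parallel_gen` at `(q, u) = (2, u − 1)`, whose contraction half is the tree's
row `q = 2` on `M ／ e` (`profileIneq_two_all'`); a point `z` of a rank-2 set with `≥ 4` points of a simple matroid
is deleted by Theorem A; what is left is a simple matroid in which every rank-2 set has at most three points —
the class of the hypothesis.  At `u = 4` the ranks `≤ 4` are discharged as well (`ρ(E) < 4`: every price is `0`;
`ρ(E) = 4`: the top level `Profile.profileIneq_top`), for night-3's Theorem L3
(`profileIneq_three_four_of_short_lines_rank_ge_five`).

* `mem_clF_iff_rk_insert_eq`, `clF_mono_sub`, `mem_clF_pair_of_line`, `exists_pair_sdiff`;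
* **`noSplit_of_four_point_line`**; `rk_pair_of_simple'`;
* **`profileIneq_three_of_four_point_line`**, **`profileIneq_three_of_four_point_line_simple`**;
* `simple'_of_no_loop_no_parallel`; **`profileIneq_three_of_simple_short_lines`**, **`profileIneq_three_of_simple`**;
* `profileIneq_of_rk_lt'`; **`profileIneq_three_four_of_short_lines_rank_ge_five`**.
-/

open scoped Matroid

namespace PercRepro.Cogirth

open Finset ThmH Skew Shadow Profile

variable {α : Type} [DecidableEq α] {M : Matroid α} [M.Finite]

/-! ### Points of a line with at least four points have no split sets -/

/-- `z ∈ cl X` iff `ρ(X ∪ z) = ρ(X)` (`z ∈ E`, `X ⊆ E`). -/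
theorem mem_clF_iff_rk_insert_eq {z : α} (hz : z ∈ gr M) {X : Finset α} (hX : X ⊆ gr M) :
    z ∈ clF M X ↔ rk M (insert z X) = rk M X := by
  rw [rk_insert_eq hz hX]
  split_ifs with h
  · exact ⟨fun _ => rfl, fun _ => h⟩
  · exact ⟨fun h' => absurd h' h, fun h' => by omega⟩

omit [DecidableEq α] in
/-- `clF` is monotone. -/
theorem clF_mono_sub {X Y : Finset α} (h : X ⊆ Y) : clF M X ⊆ clF M Y := by
  intro x hx
  rw [← mem_coe, coe_clF] at hx ⊢
  exact M.closure_subset_closure (by exact_mod_cast h) hx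

/-- Two distinct points `x, y` of a rank-2 set `L ∋ z` spanning a rank-2 pair span `z`. -/
theorem mem_clF_pair_of_line {z : α} (hz : z ∈ gr M) {L : Finset α} (hL : L ⊆ gr M) (hzL : z ∈ L)
    (hrL : rk M L = 2) {x y : α} (hx : x ∈ L) (hy : y ∈ L) (hxy : rk M {x, y} = 2) :
    z ∈ clF M {x, y} := by
  have hpair : ({x, y} : Finset α) ⊆ gr M := by
    intro a ha
    rw [mem_insert, mem_singleton] at ha
    rcases ha with rfl | rfl
    · exact hL hx
    · exact hL hy
  rw [mem_clF_iff_rk_insert_eq hz hpair]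
  have h1 : rk M (insert z {x, y}) ≤ rk M L := by
    apply rk_mono_sub
    intro a ha
    rw [mem_insert, mem_insert, mem_singleton] at ha
    rcases ha with rfl | rfl | rfl
    · exact hzL
    · exact hx
    · exact hy
  have h2 : rk M {x, y} ≤ rk M (insert z {x, y}) := rk_mono_sub (subset_insert _ _)
  omega

/-- A finset with at most one element in common with a set of `≥ 3` elements leaves two distinct elements of
it outside. -/
theorem exists_pair_sdiff {L B : Finset α} (h3 : 3 ≤ L.card) (h1 : (L ∩ B).card ≤ 1) :
    ∃ x ∈ L \ B, ∃ y ∈ L \ B, x ≠ y := by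
  have hc : 2 ≤ (L \ B).card := by
    have := card_sdiff_add_card_inter L B
    omega
  obtain ⟨x, hx, y, hy, hxy⟩ := one_lt_card.1 (by omega : 1 < (L \ B).card)
  exact ⟨x, hx, y, hy, hxy⟩

/-- **No split sets at a point of a `≥ 4`-point line**: if `z` lies in a rank-2 set `L` of at least four points
any two of which span a rank-2 set (e.g. a line with `≥ 4` points of a simple matroid), then `M` has no
`z`-split set at any level. -/
theorem noSplit_of_four_point_line {z : α} (hz : z ∈ gr M) {L : Finset α} (hL : L ⊆ gr M) (hzL : z ∈ L)
    (hrL : rk M L = 2) (hcard : 4 ≤ L.card) (hpairs : ∀ x ∈ L, ∀ y ∈ L, x ≠ y → rk M {x, y} = 2) (u : ℕ) :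
    NoSplit M z u := by
  intro B hB hzB _ hdrop
  have hBg : B ⊆ gr M := (mem_Rq.1 hB).1
  set L' := L.erase z with hL'
  have hL'card : 3 ≤ L'.card := by rw [hL', card_erase_of_mem hzL]; omega
  by_cases hmeet : 2 ≤ (L' ∩ B).card
  · -- two points of the line inside `B` span `z`
    obtain ⟨x, hx, y, hy, hxy⟩ := one_lt_card.1 (by omega : 1 < (L' ∩ B).card)
    rw [mem_inter, hL', mem_erase] at hx hy
    have hxy2 : rk M {x, y} = 2 := hpairs x hx.1.2 y hy.1.2 hxy
    have hzxy : z ∈ clF M {x, y} := mem_clF_pair_of_line hz hL hzL hrL hx.1.2 hy.1.2 hxy2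
    refine clF_mono_sub ?_ hzxy
    intro a ha
    rw [mem_insert, mem_singleton] at ha
    rcases ha with rfl | rfl
    · exact hx.2
    · exact hy.2
  · -- two points of the line outside `B ∪ z` span `z`: the rank of `E ∖ B` does not drop
    exfalso
    obtain ⟨x, hx, y, hy, hxy⟩ := exists_pair_sdiff (L := L') (B := B) hL'card (by omega)
    rw [mem_sdiff, hL', mem_erase] at hx hy
    have hxy2 : rk M {x, y} = 2 := hpairs x hx.1.2 y hy.1.2 hxy
    have hzxy : z ∈ clF M {x, y} := mem_clF_pair_of_line hz hL hzL hrL hx.1.2 hy.1.2 hxy2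
    have hsub : ({x, y} : Finset α) ⊆ (gr M \ B).erase z := by
      intro a ha
      rw [mem_insert, mem_singleton] at ha
      rw [mem_erase, mem_sdiff]
      rcases ha with rfl | rfl
      · exact ⟨hx.1.1, hL hx.1.2, hx.2⟩
      · exact ⟨hy.1.1, hL hy.1.2, hy.2⟩
    have hzcl : z ∈ clF M ((gr M \ B).erase z) := clF_mono_sub hsub hzxy
    have hC : (gr M \ B).erase z ⊆ gr M := (erase_subset z _).trans sdiff_subset
    have hins : insert z ((gr M \ B).erase z) = gr M \ B :=
      insert_erase (mem_sdiff.2 ⟨hz, hzB⟩)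
    have := (mem_clF_iff_rk_insert_eq hz hC).1 hzcl
    rw [hins] at this
    omega

/-- **THE ROW `q = 3` LIFTS OVER A POINT OF A `≥ 4`-POINT LINE.**  If `z` lies in a rank-2 set `L` of at least
four points, any two of which span a rank-2 set, then for every `u ≥ 4`: `(Π_{3,u})(M ∖ z) ⟹ (Π_{3,u})(M)`. -/
theorem profileIneq_three_of_four_point_line {z : α} (hz : M.Indep {z}) {L : Finset α} (hL : L ⊆ gr M)
    (hzL : z ∈ L) (hrL : rk M L = 2) (hcard : 4 ≤ L.card)
    (hpairs : ∀ x ∈ L, ∀ y ∈ L, x ≠ y → rk M {x, y} = 2) {u : ℕ} (hu : 4 ≤ u)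
    (hdel : ProfileIneq (M ＼ ({z} : Set α)) 3 u) : ProfileIneq M 3 u :=
  profileIneq_three_of_noSplit hz hu
    (noSplit_of_four_point_line (mem_gr_of_indep hz) hL hzL hrL hcard hpairs u) hdel

/-- In a simple matroid every pair of distinct ground elements has rank `2`. -/
theorem rk_pair_of_simple' (hs : Simple' M) {x y : α} (hx : x ∈ gr M) (hy : y ∈ gr M) (hxy : x ≠ y) :
    rk M {x, y} = 2 := by
  have hsub : ({x, y} : Finset α) ⊆ gr M := by
    intro a ha
    rw [mem_insert, mem_singleton] at ha
    rcases ha with rfl | rfl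
    · exact hx
    · exact hy
  have hcard : ({x, y} : Finset α).card = 2 := card_pair hxy
  have hind := hs _ hsub (by omega)
  unfold rk
  rw [hind.eRk_eq_encard, Set.encard_coe_eq_coe_finsetCard, hcard]
  rfl

/-- **THE ROW `q = 3` ON A SIMPLE MATROID LIFTS OVER A POINT OF A LINE WITH `≥ 4` POINTS**: for a simple `M`,
a rank-2 set `L ∋ z` with `≥ 4` points and `u ≥ 4`, `(Π_{3,u})(M ∖ z) ⟹ (Π_{3,u})(M)`. -/
theorem profileIneq_three_of_four_point_line_simple (hs : Simple' M) {z : α} (hz : z ∈ gr M) {L : Finset α}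
    (hL : L ⊆ gr M) (hzL : z ∈ L) (hrL : rk M L = 2) (hcard : 4 ≤ L.card) {u : ℕ} (hu : 4 ≤ u)
    (hdel : ProfileIneq (M ＼ ({z} : Set α)) 3 u) : ProfileIneq M 3 u := by
  have hzi : M.Indep ({z} : Set α) := by
    have := hs {z} (singleton_subset_iff.2 hz) (by simp)
    simpa using this
  exact profileIneq_three_of_four_point_line hzi hL hzL hrL hcard
    (fun x hx y hy hxy => rk_pair_of_simple' hs (hL hx) (hL hy) hxy) hu hdel


omit [DecidableEq α] in
/-- A matroid without loops and without parallel pairs is `Simple'`. -/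
theorem simple'_of_no_loop_no_parallel (hl : ∀ x ∈ M.E, M.IsNonloop x)
    (hp : ∀ e f : α, f ∈ M.E → f ≠ e → e ∉ M.closure {f}) : Simple' M := by
  intro B hB hcard
  apply simple_of_no_loop_no_parallel hl hp
  · rw [← coe_gr]; exact_mod_cast hB
  · rw [Set.encard_coe_eq_coe_finsetCard]; exact_mod_cast hcard

/-- **THE REDUCTION OF THE ROW `q = 3` TO SIMPLE MATROIDS WITH SHORT LINES.**  If `(Π_{3,u})` holds on every simple
finite matroid in which every rank-2 subset of the ground set has at most three elements, then it holds on every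
finite matroid (`u ≥ 4`). -/
theorem profileIneq_three_of_simple_short_lines {u : ℕ} (hu : 4 ≤ u)
    (hS : ∀ (N : Matroid α) [N.Finite], Simple' N → (∀ L ⊆ gr N, rk N L = 2 → L.card ≤ 3) →
      ProfileIneq N 3 u)
    (M : Matroid α) [M.Finite] : ProfileIneq M 3 u := by
  suffices h : ∀ n : ℕ, ∀ (N : Matroid α) [N.Finite], (gr N).card = n → ProfileIneq N 3 u from h _ M rfl
  intro n
  induction n using Nat.strong_induction_on with
  | _ n ih =>
  intro N _ hN
  by_cases hloop : ∃ ℓ, N.IsLoop ℓ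
  · obtain ⟨ℓ, hℓ⟩ := hloop
    have hℓE : ℓ ∈ gr N := by rw [← Finset.mem_coe, coe_gr]; exact hℓ.mem_ground
    apply profileIneq_of_delete_isLoop hℓ
    apply ih ((gr N).erase ℓ).card _ (N ＼ ({ℓ} : Set α)) (by rw [gr_delete_singleton''])
    rw [← hN]; exact Finset.card_erase_lt_of_mem hℓE
  · have hl : ∀ x ∈ N.E, N.IsNonloop x := fun x hx => N.isNonloop_of_not_isLoop hx (fun h => hloop ⟨x, h⟩)
    by_cases hpar : ∃ e f, f ∈ N.E ∧ f ≠ e ∧ e ∈ N.closure {f}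
    · obtain ⟨e, f, hfE, hfe, hef⟩ := hpar
      have heE : e ∈ gr N := by rw [← Finset.mem_coe, coe_gr]; exact N.closure_subset_ground _ hef
      have hlt : ((gr N).erase e).card < n := by rw [← hN]; exact Finset.card_erase_lt_of_mem heE
      have hu' : u = (u - 1) + 1 := by omega
      rw [hu']
      apply profileIneq_of_delete_parallel_gen hl hfE hfe hef (by omega)
      · rw [← hu']
        exact ih _ hlt (N ＼ ({e} : Set α)) (by rw [gr_delete_singleton''])
      · exact profileIneq_two_all' (N ／ ({e} : Set α)) (by omega)
    · have hs : Simple' N := simple'_of_no_loop_no_parallel hl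
        (fun e f hfE hfe hef => hpar ⟨e, f, hfE, hfe, hef⟩)
      by_cases hline : ∃ L ⊆ gr N, rk N L = 2 ∧ 4 ≤ L.card
      · obtain ⟨L, hL, hrL, hcard⟩ := hline
        have hne : L.Nonempty := Finset.card_pos.1 (by omega)
        obtain ⟨z, hzL⟩ := hne
        have hzE : z ∈ gr N := hL hzL
        have hlt : ((gr N).erase z).card < n := by rw [← hN]; exact Finset.card_erase_lt_of_mem hzE
        apply profileIneq_three_of_four_point_line_simple hs hzE hL hzL hrL hcard hu
        exact ih _ hlt (N ＼ ({z} : Set α)) (by rw [gr_delete_singleton''])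
      · exact hS N hs (fun L hL hrL => by
          by_contra h
          exact hline ⟨L, hL, hrL, by omega⟩)

/-- **THE ROW `q = 3` ON EVERY FINITE MATROID FROM THE ROW ON SIMPLE MATROIDS** (`u ≥ 4`). -/
theorem profileIneq_three_of_simple {u : ℕ} (hu : 4 ≤ u)
    (hS : ∀ (N : Matroid α) [N.Finite], Simple' N → ProfileIneq N 3 u) (M : Matroid α) [M.Finite] :
    ProfileIneq M 3 u :=
  profileIneq_three_of_simple_short_lines hu (fun N _ hs _ => hS N hs) M


/-- `(Π_{q,u})` holds trivially when `ρ(E) < u`: every price vanishes. -/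
theorem profileIneq_of_rk_lt' {q u : ℕ} (h : rk M (gr M) < u) : ProfileIneq M q u := by
  unfold ProfileIneq
  have hzero : ∀ B ∈ Rq M q, price M q u B = 0 := by
    intro B _
    unfold price
    rw [if_neg]
    intro hle
    have h1 : M.eRk ((gr M \ B : Finset α) : Set α) ≤ M.eRk (gr M : Set α) :=
      M.eRk_mono (by exact_mod_cast (sdiff_subset : gr M \ B ⊆ gr M))
    have h2 := le_trans hle h1
    rw [← coe_rk] at h2
    have : u ≤ rk M (gr M) := by exact_mod_cast h2
    omega
  rw [sum_eq_zero hzero]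
  exact_mod_cast Nat.zero_le _

/-- **THE ROW `(3,4)` ON EVERY FINITE MATROID** from the simple matroids of rank `≥ 5` with all lines `≤ 3` points. -/
theorem profileIneq_three_four_of_short_lines_rank_ge_five
    (hS : ∀ (N : Matroid α) [N.Finite], Simple' N → (∀ L ⊆ gr N, rk N L = 2 → L.card ≤ 3) →
      5 ≤ rk N (gr N) → ProfileIneq N 3 4)
    (M : Matroid α) [M.Finite] : ProfileIneq M 3 4 := by
  apply profileIneq_three_of_simple_short_lines (le_refl 4)
  intro N _ hs hlines
  rcases Nat.lt_or_ge (rk N (gr N)) 4 with hlt | hge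
  · exact profileIneq_of_rk_lt' hlt
  · rcases Nat.lt_or_ge (rk N (gr N)) 5 with hlt5 | hge5
    · have h4 : rk N (gr N) = 4 := by omega
      have hR : N.eRank = (4 : ℕ) := by
        rw [Matroid.eRank_def, ← coe_gr, ← coe_rk, h4]
      exact Profile.profileIneq_top hR 3
    · exact hS N hs hlines hge5


end PercRepro.Cogirth
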